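/-
Copyright (c) 2026 the pub-hodgecm-mathlib formalisation cell (harness21).  Prover seat hodgecm-mathlib-LH4-p05 (g9) (β chair from LEDGER #20), req620 Track A «(D-RAM) FOUR-FRAME»
squad, helper lane on h413 = stmt-HodgeConjecture-24833 (count-neutral).  β-BOARD v1 ROW R8 ∕ (P5) — THE ∀-CLOSED LATTICE SCHEMA `hB` of `hRest_of_heads` (LEDGER #20 (B₃)),
discharged from LH7-p08 (g0)'s ★ p862216 boundary H row (FILE 4c); placement read kernel-checked first by QA LH-ref2 (g13) (T2 rider (b)).  2026-09-04.
-/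
import Summits.HodgeConjecture.HodgeConjecture.Theorems.F0P3cDyRamLabelledOddCoreHangingBoundarySum   -- ★ p862216 (LH7-p08 (g0)): `finsum_stratum_H_shell_labelledOdd_div_relIndex_eq_of_boundary₃`
import Summits.HodgeConjecture.HodgeConjecture.Theorems.F0P3cDyRamStageOneBDerivedDefs              -- ★: `n0DerivedOfRecord`, `mcOfRecord_le_n0DerivedOfRecord`
import HarnessLib

/-!
# Crux `H413`, line LH4 «(D-RAM) FOUR-FRAME» — (β-BAL) Stage B, β-BOARD ROW R8 ∕ (P5): THE SCHEMA `hB` (B₃) OF `hRest_of_heads`, CLOSED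

Cell `hodgecm-mathlib` (D-0151), FLOOR 0, crux item H413 = `stmt-HodgeConjecture-24833`, route `HCCMUnconditional`; squad F0∕P3c∕LH4.  THEOREMS ONLY (no `def`, no instance, no
notation, no `sorry`, default heartbeats); ★-only imports; lane `--supports stmt-HodgeConjecture-24833 --as helper` (count-neutral); pays NO row, states NO law.

WHAT.  F0P3a-p01 (g37)'s ★ p862244 `F0P3cDyRamOddLabelledRestOfHeads.hRest_of_heads (hK) (hW) (hB) (hZ)` takes four ∀-closed lattice schemas; `hB` is the BOUNDARY H row at the
placement `n₁ = n₂`, `n₃ + 2 = n₁ + 2d`, `2ρ + d % 2 = n₁`, quantified over the field, the ramified datum, the element datum at `n0DerivedOfRecord d`, the frame `T = diag(α, β, 1)`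
and the two tower-sign tokens `e_A` (of `α − 1` at `n₂`) and `e_B` (of `β − 1` at `n₁`), with value `(0, 0, −(ω(−1)ω(e_B) + ω(−1)ω(e_A)))_i ∕ 2 · q^{2ρ−1}`.  LH7-p08 (g0)'s
★ p862216 head `finsum_stratum_H_shell_labelledOdd_div_relIndex_eq_of_boundary₃` proves that row at any `N₀` with `mcOfRecord d ≤ N₀` with the value written
`(0, 0, −ω(−1)·(ω(e_A) + ω(e_B)))_i ∕ 2 · q^{2ρ−1}`; at `N₀ = n0DerivedOfRecord d` (★ `mcOfRecord_le_n0DerivedOfRecord`) the two slot vectors agree entrywise (`ring` in slot 2).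
Hence **`boundarySchema_H`**, whose TYPE is the `hB` binder of `hRest_of_heads` VERBATIM: `hRest_of_heads ‹hK› ‹hW› boundarySchema_H ‹hZ›` (with ★ p862300 `kappaSchema_G1` for
`hK`).  The 4-line proof is QA LH-ref2 (g13)'s by-import rider (b) leg `hB_of_boundarySum`, placed here as the file of record.
HONEST LABEL.  Count-neutral (`--supports`); nothing printed is asserted; the schemas `hW hZ`, the pay file, (β) `stub_law_cleanSgn`, T₊ remain OPEN; `HC_CM` is proved only modulo
the 7 printed citations (2 remaining named inputs: hLiu418 = `stmt-HodgeConjecture-24832`, h413 = `stmt-HodgeConjecture-24833`) until rung 0 closes.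
References: [Kottwitz1986BaseChangeUnits] §1 pp. 240–241 · [LanglandsShelstad1987] §3 · [Rogawski1990] §4.9 Prop. 4.9.1 (a)(b) p. 55, §4.10 p. 58 · [Serre1979] Ch. XV §2.
-/

set_option autoImplicit false

noncomputable section

namespace Summit.HodgeConjecture.HodgeConjecture.Cruxes.H413.F0P3cDyRamLabelledOddCoreHangingBoundarySchema

open Matrix WithZero
open Literature.NumberTheory.Automorphic Literature.NumberTheory.Automorphic.HermitianLattice Literature.NumberTheory.Automorphic.UnitaryGroup
open Literature.NumberTheory.Automorphic.UnitaryLatticeTree Literature.NumberTheory.Automorphic.UnitaryThreeFourFrame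
open Literature.NumberTheory.LocalFields Literature.NumberTheory.LocalFields.WildQuadraticDatum
open Summit.HodgeConjecture.HodgeConjecture.Cruxes.H413.F0P3cDyRamFourFramePieces
open Summit.HodgeConjecture.HodgeConjecture.Cruxes.H413.F0P3cDyRamFourFrameCensusDefs
open Summit.HodgeConjecture.HodgeConjecture.Cruxes.H413.F0P3cDyRamStageOneBDefs (mcOfRecord)
open Summit.HodgeConjecture.HodgeConjecture.Cruxes.H413.F0P3cDyRamStageOneBDerivedDefs (n0DerivedOfRecord mcOfRecord_le_n0DerivedOfRecord)
open Summit.HodgeConjecture.HodgeConjecture.Cruxes.H413.F0P3cDyRamDiagonalTorusDefs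
open Summit.HodgeConjecture.HodgeConjecture.Cruxes.H413.F0P3cDyRamDiagonalStrataDefs
open Summit.HodgeConjecture.HodgeConjecture.Cruxes.H413.F0P3cDyRamLabelledOddCountDefs
open Summit.HodgeConjecture.HodgeConjecture.Cruxes.H413.F0P3cDyRamLabelledOddCoreHangingBoundarySum (finsum_stratum_H_shell_labelledOdd_div_relIndex_eq_of_boundary₃)
open scoped Valued WithZero Matrix MatrixGroups

/-- **β-BOARD R8 ∕ (P5) — THE SCHEMA `hB` (B₃) OF `hRest_of_heads`, CLOSED**: for every complete discretely valued `K` with finite residue field `q = #𝓀`, every ramified datum with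
`|2| < 1`, every element datum at `n0DerivedOfRecord d`, `T = diag(α, β, 1)`, every token `e_A` of `α − 1` at `n₂` and `e_B` of `β − 1` at `n₁`: at the boundary placement `n₁ = n₂`,
`n₃ + 2 = n₁ + 2d`, `2ρ + d%2 = n₁` (`ρ ≥ 1`), for every slot `i`,
`Σᶠ_{M ∈ stratum σ ϖ T (2ρ,2ρ,2ρ), clean shell} labelledOddCount σ ϖ 0 i Λ M ∕ [𝒰 : N(S̃′(M))] = (0, 0, −(ω(−1)ω(e_B) + ω(−1)ω(e_A)))_i ∕ 2 · q^{2ρ−1}` (`Λ = valueClassLabel σ ϖ (α−1) (β−1) m* d`)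
— ★ p862216's boundary H row at `N₀ = n0DerivedOfRecord d`, slot vector rewritten by `ring`.  The type is `hRest_of_heads`'s `hB` binder VERBATIM.
[cite: Kottwitz1986BaseChangeUnits, §1 pp. 240–241] [cite: LanglandsShelstad1987, §3] [cite: Rogawski1990, §4.9 Prop. 4.9.1 (a)(b) p. 55, §4.10 p. 58] [cite: Serre1979, Ch. XV §2] -/
theorem boundarySchema_H :
    ∀ {K : Type} [Field K] [Valued K ℤᵐ⁰] [CompleteSpace K] [Fintype 𝓀[K]] (σ : K →+* K) (ϖ : K) (d t : ℕ),
      Valued.v (2 : K) < 1 → IsRamifiedQuadraticDatum σ ϖ d t →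
      ∀ (α β : K) (n₁ n₂ n₃ : ℕ), IsElementDatum σ ϖ (n0DerivedOfRecord d) α β n₁ n₂ n₃ →
      ∀ (T : GL (Fin 3) K), (T : Matrix (Fin 3) (Fin 3) K) = Matrix.diagonal ![α, β, 1] →
      ∀ {eA eB : K}, σ eA = eA → Valued.v eA = 1 → Valued.v ((ϖ ^ mstarOfRecord d)⁻¹ * ((α - 1) * ((ϖ * σ ϖ) ^ ((n₂ - d % 2) / 2))⁻¹ - eA * ((ϖ - σ ϖ) * ((ϖ * σ ϖ) ^ ((d - d % 2) / 2))⁻¹))) ≤ 1 →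
        σ eB = eB → Valued.v eB = 1 → Valued.v ((ϖ ^ mstarOfRecord d)⁻¹ * ((β - 1) * ((ϖ * σ ϖ) ^ ((n₁ - d % 2) / 2))⁻¹ - eB * ((ϖ - σ ϖ) * ((ϖ * σ ϖ) ^ ((d - d % 2) / 2))⁻¹))) ≤ 1 →
      n₁ = n₂ → n₃ + 2 = n₁ + 2 * d → ∀ ρ : ℕ, 1 ≤ ρ → 2 * ρ + d % 2 = n₁ → ∀ i : Fin 3,
      ∑ᶠ M ∈ {M : Submodule 𝒪[K] (Fin 3 → K) | M ∈ stratum σ ϖ T ![2 * ρ, 2 * ρ, 2 * ρ] ∧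
          (LatticeInLevel ϖ (d % 2) (Matrix.diagonal ![α - 1, β - 1, 0]) M ∧ ¬ LatticeInLevel ϖ (d % 2 + 1) (Matrix.diagonal ![α - 1, β - 1, 0]) M ∧
            LatticeInLevel ϖ (mcOfRecord d) (Matrix.diagonal ![(α - 1) * (α - 1), (β - 1) * (β - 1), 0]) M)},
        (labelledOddCount σ ϖ 0 i (valueClassLabel σ ϖ (α - 1) (β - 1) (mstarOfRecord d) d) M : ℚ) /
          ((((unitStabilizer M).map (unitNormMap σ 3)).relIndex (fixedUnitTorus σ 3) : ℕ) : ℚ) =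
        (((![0, 0, -(normSign σ (-1 : K) * normSign σ eB + normSign σ (-1 : K) * normSign σ eA)] : Fin 3 → ℤ) i : ℤ) : ℚ) / 2 * (Nat.card 𝓀[K] : ℚ) ^ (2 * ρ - 1) := by
  intro K _ _ _ _ σ ϖ d t h2 hD α β n₁ n₂ n₃ hE T hT eA eB hσeA heA1 heA hσeB _heB1 heB h12 hbdry ρ hρ h2ρ i
  rw [finsum_stratum_H_shell_labelledOdd_div_relIndex_eq_of_boundary₃ hD h2 hE (mcOfRecord_le_n0DerivedOfRecord d) h12 hbdry T hT ρ hρ h2ρ hσeA heA1 hσeB heA heB i]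
  congr 3
  fin_cases i <;> simp
  ring

end Summit.HodgeConjecture.HodgeConjecture.Cruxes.H413.F0P3cDyRamLabelledOddCoreHangingBoundarySchema

end
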